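import Literature.Computability.QuantumComplexity.SignedCubicForrelation
import Literature.Computability.QuantumComplexity.ForrelationMSubspaceDuality
import Literature.Computability.QuantumComplexity.ForrelationCosetAffineBound
import Literature.Computability.Complexity.F2RowReduction
import Literature.Computability.Complexity.StackLists
import Summits.QuantumAdvantage.QuantumAdvantage.Theorems.CubicForrelationSignedCubicForrelationInPrBPPStubSafeMMR

/-!
# Crux `CubicForrelation.SignedCubicForrelationInPrBPP` (stmt-QuantumAdvantage-13933)

Stub `stub_safeMM` of the line `polar-radical-seeds` (registered skeleton r2,
`Cruxes/SignedCubicForrelationInPrBPP/Lines/polar_radical_seeds.lean`): the EXACT safe partial decider of the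
Maiorana–McFarland side of `signedCubicForrelationProblem 2` (half-dimensional M-subspaces, rank certificate
`2 · rank = n`) is the case `c = c' = 0` of the RELAXED one `stub_safeMMR` (M-defect `≤ c log₂(n+2)`, rank
certificate `n ≤ 2 · rank + c' log₂(n+2)`; landed in `…StubSafeMMR.lean`, machine `MMReadout.outR`).

The only mathematics: on a promise instance (`|Φ| ≥ 3/5`, `n` even) a `⊕`-closed `V ∋ 0` on whose cosets
one function is affine has `|V|² ≤ 2ⁿ` (`DerivativeWalsh.abs_forrelation_le_half_of_affine_on_cosets`: `|V|² > 2ⁿ`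
forces `|Φ| ≤ 1/2`), so "`2ⁿ ≤ |V|² · (n+2)⁰`" and "`|V|² = 2ⁿ`" describe the same subspaces; the finder
event `2 · rank = n` implies `n ≤ 2 · rank + 0`, and the exact side sets `EY`, `EN` are contained in the
relaxed ones. Everything else is bookkeeping (`uniformProb` is monotone in the event).
-/

noncomputable section

set_option linter.dupNamespace false -- D-0017: single-problem summit ⇒ `QuantumAdvantage.QuantumAdvantage` by design

namespace Summit.QuantumAdvantage.QuantumAdvantage.Theorems.SignedCubicForrelationInPrBPP

open Finset
open Literature.Computability.Complexity Literature.Computability.QuantumComplexity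
open Literature.Computability.QuantumComplexity.BuzetChailloux (bxor zeroVec)

/-- Monotonicity of the counting probability under inclusion of events (Arora–Barak 2009, §A.2). -/
private theorem safeMM_uniformProb_mono {m : ℕ} {E E' : Set (List Bool)} (h : E ⊆ E') :
    uniformProb m E ≤ uniformProb m E' := by
  classical
  rw [uniformProb_eq_cnt_div, uniformProb_eq_cnt_div]
  refine div_le_div_of_nonneg_right ?_ (by positivity)
  have hle : cnt m E ≤ cnt m E' := by
    unfold cnt
    refine Finset.card_le_card fun r hr => ?_
    simp only [Finset.mem_filter, Finset.mem_univ, true_and] at hr ⊢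
    exact h hr
  exact_mod_cast hle

/-- **On the promise, a coset-affine subspace is at most half-dimensional.** If `n` is even, `|Φ(f,g)| ≥ 3/5`
and `g` is affine on every coset of the `⊕`-closed `V ∋ 0`, then `|V|² ≤ 2ⁿ` (otherwise `|Φ| ≤ 1/2`,
`DerivativeWalsh.abs_forrelation_le_half_of_affine_on_cosets`). -/
theorem card_sq_le_two_pow_of_affine_on_cosets {n : ℕ} (f g : (Fin n → Bool) → Bool)
    {V : Finset (Fin n → Bool)} (hn : Even n) (h0 : zeroVec ∈ V) (hadd : ∀ x ∈ V, ∀ y ∈ V, bxor x y ∈ V)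
    (hM : ∀ u ∈ V, ∀ v ∈ V, ∀ y, (g y ^^ g (bxor y u) ^^ g (bxor y v) ^^ g (bxor y (bxor u v))) = false)
    (hΦ : (3 / 5 : ℝ) ≤ |forrelation f g|) : V.card ^ 2 ≤ 2 ^ n := by
  by_contra hlt
  have h := DerivativeWalsh.abs_forrelation_le_half_of_affine_on_cosets f g hn h0 hadd hM (not_le.1 hlt)
  linarith

/-- Hence, on the promise, "`2ⁿ ≤ |V|² · (n+2)^{2·0}`" (M-defect `≤ 0 · log`) already forces `|V|² = 2ⁿ`
(as real numbers, the form used by the exact stub `stub_safeMM`). -/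
theorem card_sq_eq_two_pow_of_relaxed_zero {n : ℕ} (f g : (Fin n → Bool) → Bool)
    {V : Finset (Fin n → Bool)} (hn : Even n) (h0 : zeroVec ∈ V) (hadd : ∀ x ∈ V, ∀ y ∈ V, bxor x y ∈ V)
    (hM : ∀ u ∈ V, ∀ v ∈ V, ∀ y, (g y ^^ g (bxor y u) ^^ g (bxor y v) ^^ g (bxor y (bxor u v))) = false)
    (hΦ : (3 / 5 : ℝ) ≤ |forrelation f g|) (hbig : 2 ^ n ≤ V.card ^ 2 * (n + 2) ^ (2 * 0)) :
    (V.card : ℝ) ^ 2 = (2 : ℝ) ^ n := by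
  have hle := card_sq_le_two_pow_of_affine_on_cosets f g hn h0 hadd hM hΦ
  have hge : 2 ^ n ≤ V.card ^ 2 := by simpa using hbig
  have heq : V.card ^ 2 = 2 ^ n := le_antisymm hle hge
  exact_mod_cast heq

/-- **`stub_safeMM` is the case `c = c' = 0` of `stub_safeMMR`.** The hypothesis is the registered signature of
`stub_safeMMR` verbatim, the conclusion the registered signature of `stub_safeMM` verbatim. -/
theorem stub_safeMM_of_safeMMR
    (hR : ∀ c c' : ℕ,
    (∃ find ∈ FP, ∃ p : Polynomial ℕ, ∀ (I : KForrelationInstance) (hk : I.k = 2),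
      Even I.n → I.IsOverB2 → (∀ i, IsDegLeFun 3 (I.C i).eval) → (3 / 5 : ℝ) ≤ |I.value| →
      (∃ V : Finset (Fin I.n → Bool), zeroVec ∈ V ∧ (∀ x ∈ V, ∀ y ∈ V, bxor x y ∈ V) ∧
        2 ^ I.n ≤ V.card ^ 2 * (I.n + 2) ^ (2 * c) ∧
        ∀ u ∈ V, ∀ v ∈ V, ∀ y, ((I.C (Fin.cast hk.symm 1)).eval y ^^
          (I.C (Fin.cast hk.symm 1)).eval (bxor y u) ^^ (I.C (Fin.cast hk.symm 1)).eval (bxor y v) ^^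
          (I.C (Fin.cast hk.symm 1)).eval (bxor y (bxor u v))) = false) →
      (2 / 3 : ℝ) ≤ uniformProb (p.eval I.encode.length)
        {y | ∃ L : List (List Bool), find (boolPair I.encode y) = encList L ∧
          I.n ≤ 2 * Module.finrank (ZMod 2) ↥(F2Elim.rowSpan I.n L) + c' * Nat.log 2 (I.n + 2) ∧
          ∀ u v : Fin I.n → Bool, (fun i => if u i then (1 : ZMod 2) else 0) ∈ F2Elim.rowSpan I.n L →
            (fun i => if v i then (1 : ZMod 2) else 0) ∈ F2Elim.rowSpan I.n L →
          ∀ y, ((I.C (Fin.cast hk.symm 1)).eval y ^^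
            (I.C (Fin.cast hk.symm 1)).eval (bxor y u) ^^ (I.C (Fin.cast hk.symm 1)).eval (bxor y v) ^^
            (I.C (Fin.cast hk.symm 1)).eval (bxor y (bxor u v))) = false}) →
    (∀ (n : ℕ) (f g : (Fin n → Bool) → Bool) (V : Finset (Fin n → Bool)),
      zeroVec ∈ V → (∀ x ∈ V, ∀ y ∈ V, bxor x y ∈ V) →
      (∀ u ∈ V, ∀ v ∈ V, ∀ y, (g y ^^ g (bxor y u) ^^ g (bxor y v) ^^ g (bxor y (bxor u v))) = false) →
      (∑ z : Fin n → Bool,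
          ∑ x ∈ univ.filter (fun x => ∀ v ∈ V, twist x v = signOf (g (bxor z v)) * signOf (g z)),
            signOf (f x) * signOf (g z) * twist x z =
        Real.sqrt (2 ^ (3 * n)) * forrelation f g) ∧
      (∀ z : Fin n → Bool,
        ((univ.filter (fun x => ∀ v ∈ V, twist x v = signOf (g (bxor z v)) * signOf (g z))).card : ℝ) *
          V.card = (2 : ℝ) ^ n)) →
    (∀ (n : ℕ) (g : (Fin n → Bool) → Bool), IsDegLeFun 3 g →
      ∀ L : List (List Bool),
      (∀ r ∈ L, ∀ s ∈ L, ∀ y : Fin n → Bool, (y = zeroVec ∨ ∃ i : Fin n, y = fun j => decide (j = i)) →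
        (g y ^^ g (bxor y (fun i => r.getD i false)) ^^ g (bxor y (fun i => s.getD i false)) ^^
          g (bxor y (bxor (fun i => r.getD i false) (fun i => s.getD i false)))) = false) →
      ∀ u v : Fin n → Bool, (fun i => if u i then (1 : ZMod 2) else 0) ∈ F2Elim.rowSpan n L →
        (fun i => if v i then (1 : ZMod 2) else 0) ∈ F2Elim.rowSpan n L →
      ∀ y, (g y ^^ g (bxor y u) ^^ g (bxor y v) ^^ g (bxor y (bxor u v))) = false) →
    ∃ dec ∈ FP, ∃ p : Polynomial ℕ,
      (∀ x ∈ (signedCubicForrelationProblem 2).yes,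
        uniformProb (p.eval x.length) {y | dec (boolPair x y) = [false]} ≤ 1 / 10) ∧
      (∀ x ∈ (signedCubicForrelationProblem 2).no,
        uniformProb (p.eval x.length) {y | dec (boolPair x y) = [true]} ≤ 1 / 10) ∧
      (∀ x ∈ KForrelationInstance.encode ''
          {I | I.IsYes ∧ (∃ i, ∃ V : Finset (Fin I.n → Bool), zeroVec ∈ V ∧
            (∀ x ∈ V, ∀ y ∈ V, bxor x y ∈ V) ∧ 2 ^ I.n ≤ V.card ^ 2 * (I.n + 2) ^ (2 * c) ∧
            ∀ u ∈ V, ∀ v ∈ V, ∀ y, ((I.C i).eval y ^^ (I.C i).eval (bxor y u) ^^ (I.C i).eval (bxor y v) ^^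
              (I.C i).eval (bxor y (bxor u v))) = false) ∧
            I.k = 2 ∧ Even I.n ∧ ∀ i, IsDegLeFun 3 (I.C i).eval},
        (9 / 10 : ℝ) ≤ uniformProb (p.eval x.length) {y | dec (boolPair x y) = [true]}) ∧
      (∀ x ∈ KForrelationInstance.encode ''
          {I | (I.IsOverB2 ∧ I.value ≤ -(3 / 5 : ℝ)) ∧ (∃ i, ∃ V : Finset (Fin I.n → Bool), zeroVec ∈ V ∧
            (∀ x ∈ V, ∀ y ∈ V, bxor x y ∈ V) ∧ 2 ^ I.n ≤ V.card ^ 2 * (I.n + 2) ^ (2 * c) ∧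
            ∀ u ∈ V, ∀ v ∈ V, ∀ y, ((I.C i).eval y ^^ (I.C i).eval (bxor y u) ^^ (I.C i).eval (bxor y v) ^^
              (I.C i).eval (bxor y (bxor u v))) = false) ∧
            I.k = 2 ∧ Even I.n ∧ ∀ i, IsDegLeFun 3 (I.C i).eval},
        (9 / 10 : ℝ) ≤ uniformProb (p.eval x.length) {y | dec (boolPair x y) = [false]})) :
    (∃ find ∈ FP, ∃ p : Polynomial ℕ, ∀ (I : KForrelationInstance) (hk : I.k = 2),
      Even I.n → I.IsOverB2 → (∀ i, IsDegLeFun 3 (I.C i).eval) → (3 / 5 : ℝ) ≤ |I.value| →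
      (∃ V : Finset (Fin I.n → Bool), zeroVec ∈ V ∧ (∀ x ∈ V, ∀ y ∈ V, bxor x y ∈ V) ∧
        (V.card : ℝ) ^ 2 = (2 : ℝ) ^ I.n ∧
        ∀ u ∈ V, ∀ v ∈ V, ∀ y, ((I.C (Fin.cast hk.symm 1)).eval y ^^
          (I.C (Fin.cast hk.symm 1)).eval (bxor y u) ^^ (I.C (Fin.cast hk.symm 1)).eval (bxor y v) ^^
          (I.C (Fin.cast hk.symm 1)).eval (bxor y (bxor u v))) = false) →
      (2 / 3 : ℝ) ≤ uniformProb (p.eval I.encode.length)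
        {y | ∃ L : List (List Bool), find (boolPair I.encode y) = encList L ∧
          2 * Module.finrank (ZMod 2) ↥(F2Elim.rowSpan I.n L) = I.n ∧
          ∀ u v : Fin I.n → Bool, (fun i => if u i then (1 : ZMod 2) else 0) ∈ F2Elim.rowSpan I.n L →
            (fun i => if v i then (1 : ZMod 2) else 0) ∈ F2Elim.rowSpan I.n L →
          ∀ y, ((I.C (Fin.cast hk.symm 1)).eval y ^^
            (I.C (Fin.cast hk.symm 1)).eval (bxor y u) ^^ (I.C (Fin.cast hk.symm 1)).eval (bxor y v) ^^
            (I.C (Fin.cast hk.symm 1)).eval (bxor y (bxor u v))) = false}) →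
    (∀ (n : ℕ) (f g : (Fin n → Bool) → Bool) (V : Finset (Fin n → Bool)),
      zeroVec ∈ V → (∀ x ∈ V, ∀ y ∈ V, bxor x y ∈ V) →
      (∀ u ∈ V, ∀ v ∈ V, ∀ y, (g y ^^ g (bxor y u) ^^ g (bxor y v) ^^ g (bxor y (bxor u v))) = false) →
      (∑ z : Fin n → Bool,
          ∑ x ∈ univ.filter (fun x => ∀ v ∈ V, twist x v = signOf (g (bxor z v)) * signOf (g z)),
            signOf (f x) * signOf (g z) * twist x z =
        Real.sqrt (2 ^ (3 * n)) * forrelation f g) ∧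
      (∀ z : Fin n → Bool,
        ((univ.filter (fun x => ∀ v ∈ V, twist x v = signOf (g (bxor z v)) * signOf (g z))).card : ℝ) *
          V.card = (2 : ℝ) ^ n)) →
    (∀ (n : ℕ) (g : (Fin n → Bool) → Bool), IsDegLeFun 3 g →
      ∀ L : List (List Bool),
      (∀ r ∈ L, ∀ s ∈ L, ∀ y : Fin n → Bool, (y = zeroVec ∨ ∃ i : Fin n, y = fun j => decide (j = i)) →
        (g y ^^ g (bxor y (fun i => r.getD i false)) ^^ g (bxor y (fun i => s.getD i false)) ^^
          g (bxor y (bxor (fun i => r.getD i false) (fun i => s.getD i false)))) = false) →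
      ∀ u v : Fin n → Bool, (fun i => if u i then (1 : ZMod 2) else 0) ∈ F2Elim.rowSpan n L →
        (fun i => if v i then (1 : ZMod 2) else 0) ∈ F2Elim.rowSpan n L →
      ∀ y, (g y ^^ g (bxor y u) ^^ g (bxor y v) ^^ g (bxor y (bxor u v))) = false) →
    ∃ dec ∈ FP, ∃ p : Polynomial ℕ,
      (∀ x ∈ (signedCubicForrelationProblem 2).yes,
        uniformProb (p.eval x.length) {y | dec (boolPair x y) = [false]} ≤ 1 / 10) ∧
      (∀ x ∈ (signedCubicForrelationProblem 2).no,
        uniformProb (p.eval x.length) {y | dec (boolPair x y) = [true]} ≤ 1 / 10) ∧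
      (∀ x ∈ KForrelationInstance.encode ''
          {I | I.IsYes ∧ (∃ i, ∃ V : Finset (Fin I.n → Bool), zeroVec ∈ V ∧
            (∀ x ∈ V, ∀ y ∈ V, bxor x y ∈ V) ∧ (V.card : ℝ) ^ 2 = (2 : ℝ) ^ I.n ∧
            ∀ u ∈ V, ∀ v ∈ V, ∀ y, ((I.C i).eval y ^^ (I.C i).eval (bxor y u) ^^ (I.C i).eval (bxor y v) ^^
              (I.C i).eval (bxor y (bxor u v))) = false) ∧
            I.k = 2 ∧ Even I.n ∧ ∀ i, IsDegLeFun 3 (I.C i).eval},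
        (9 / 10 : ℝ) ≤ uniformProb (p.eval x.length) {y | dec (boolPair x y) = [true]}) ∧
      (∀ x ∈ KForrelationInstance.encode ''
          {I | (I.IsOverB2 ∧ I.value ≤ -(3 / 5 : ℝ)) ∧ (∃ i, ∃ V : Finset (Fin I.n → Bool), zeroVec ∈ V ∧
            (∀ x ∈ V, ∀ y ∈ V, bxor x y ∈ V) ∧ (V.card : ℝ) ^ 2 = (2 : ℝ) ^ I.n ∧
            ∀ u ∈ V, ∀ v ∈ V, ∀ y, ((I.C i).eval y ^^ (I.C i).eval (bxor y u) ^^ (I.C i).eval (bxor y v) ^^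
              (I.C i).eval (bxor y (bxor u v))) = false) ∧
            I.k = 2 ∧ Even I.n ∧ ∀ i, IsDegLeFun 3 (I.C i).eval},
        (9 / 10 : ℝ) ≤ uniformProb (p.eval x.length) {y | dec (boolPair x y) = [false]}) := by
  intro hF hdual hcert
  -- (1) the exact finder is a relaxed finder at `c = c' = 0`
  obtain ⟨find, hfind, p, hp⟩ := hF
  have hF' : ∃ find ∈ FP, ∃ p : Polynomial ℕ, ∀ (I : KForrelationInstance) (hk : I.k = 2),
      Even I.n → I.IsOverB2 → (∀ i, IsDegLeFun 3 (I.C i).eval) → (3 / 5 : ℝ) ≤ |I.value| →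
      (∃ V : Finset (Fin I.n → Bool), zeroVec ∈ V ∧ (∀ x ∈ V, ∀ y ∈ V, bxor x y ∈ V) ∧
        2 ^ I.n ≤ V.card ^ 2 * (I.n + 2) ^ (2 * 0) ∧
        ∀ u ∈ V, ∀ v ∈ V, ∀ y, ((I.C (Fin.cast hk.symm 1)).eval y ^^
          (I.C (Fin.cast hk.symm 1)).eval (bxor y u) ^^ (I.C (Fin.cast hk.symm 1)).eval (bxor y v) ^^
          (I.C (Fin.cast hk.symm 1)).eval (bxor y (bxor u v))) = false) →
      (2 / 3 : ℝ) ≤ uniformProb (p.eval I.encode.length)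
        {y | ∃ L : List (List Bool), find (boolPair I.encode y) = encList L ∧
          I.n ≤ 2 * Module.finrank (ZMod 2) ↥(F2Elim.rowSpan I.n L) + 0 * Nat.log 2 (I.n + 2) ∧
          ∀ u v : Fin I.n → Bool, (fun i => if u i then (1 : ZMod 2) else 0) ∈ F2Elim.rowSpan I.n L →
            (fun i => if v i then (1 : ZMod 2) else 0) ∈ F2Elim.rowSpan I.n L →
          ∀ y, ((I.C (Fin.cast hk.symm 1)).eval y ^^
            (I.C (Fin.cast hk.symm 1)).eval (bxor y u) ^^ (I.C (Fin.cast hk.symm 1)).eval (bxor y v) ^^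
            (I.C (Fin.cast hk.symm 1)).eval (bxor y (bxor u v))) = false} := by
    refine ⟨find, hfind, p, fun I hk hn hB hdeg hΦ hV => ?_⟩
    obtain ⟨V, h0, hadd, hbig, hM⟩ := hV
    have hΦ' : (3 / 5 : ℝ) ≤ |forrelation (I.C (Fin.cast hk.symm 0)).eval (I.C (Fin.cast hk.symm 1)).eval| := by
      rw [← KForrelationInstance.value_eq_forrelation hk]; exact hΦ
    have hcard := card_sq_eq_two_pow_of_relaxed_zero _ _ hn h0 hadd hM hΦ' hbig
    refine (hp I hk hn hB hdeg hΦ ⟨V, h0, hadd, hcard, hM⟩).trans (safeMM_uniformProb_mono ?_)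
    rintro y ⟨L, hL, hrank, hc⟩
    exact ⟨L, hL, by omega, hc⟩
  -- (2) run the relaxed safe partial decider at `c = c' = 0` and shrink its complete sets
  obtain ⟨dec, hdec, q, hyes, hno, hEY, hEN⟩ := hR 0 0 hF' hdual hcert
  refine ⟨dec, hdec, q, hyes, hno, ?_, ?_⟩
  · rintro x ⟨I, ⟨hIy, ⟨i, V, h0, hadd, hcard, hM⟩, hside⟩, rfl⟩
    refine hEY _ ⟨I, ⟨hIy, ⟨i, V, h0, hadd, ?_, hM⟩, hside⟩, rfl⟩
    have h : (2 : ℝ) ^ I.n ≤ (V.card : ℝ) ^ 2 * (I.n + 2 : ℝ) ^ (2 * 0) := by rw [hcard]; simp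
    exact_mod_cast h
  · rintro x ⟨I, ⟨hIn, ⟨i, V, h0, hadd, hcard, hM⟩, hside⟩, rfl⟩
    refine hEN _ ⟨I, ⟨hIn, ⟨i, V, h0, hadd, ?_, hM⟩, hside⟩, rfl⟩
    have h : (2 : ℝ) ^ I.n ≤ (V.card : ℝ) ^ 2 * (I.n + 2 : ℝ) ^ (2 * 0) := by rw [hcard]; simp
    exact_mod_cast h

/-- **Stub `stub_safeMM`** (registered signature verbatim): the safe partial decider of the (exact)
Maiorana–McFarland side of `signedCubicForrelationProblem 2` — the case `c = c' = 0` of `stub_safeMMR`. -/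
theorem stub_safeMM :
    (∃ find ∈ FP, ∃ p : Polynomial ℕ, ∀ (I : KForrelationInstance) (hk : I.k = 2),
      Even I.n → I.IsOverB2 → (∀ i, IsDegLeFun 3 (I.C i).eval) → (3 / 5 : ℝ) ≤ |I.value| →
      (∃ V : Finset (Fin I.n → Bool), zeroVec ∈ V ∧ (∀ x ∈ V, ∀ y ∈ V, bxor x y ∈ V) ∧
        (V.card : ℝ) ^ 2 = (2 : ℝ) ^ I.n ∧
        ∀ u ∈ V, ∀ v ∈ V, ∀ y, ((I.C (Fin.cast hk.symm 1)).eval y ^^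
          (I.C (Fin.cast hk.symm 1)).eval (bxor y u) ^^ (I.C (Fin.cast hk.symm 1)).eval (bxor y v) ^^
          (I.C (Fin.cast hk.symm 1)).eval (bxor y (bxor u v))) = false) →
      (2 / 3 : ℝ) ≤ uniformProb (p.eval I.encode.length)
        {y | ∃ L : List (List Bool), find (boolPair I.encode y) = encList L ∧
          2 * Module.finrank (ZMod 2) ↥(F2Elim.rowSpan I.n L) = I.n ∧
          ∀ u v : Fin I.n → Bool, (fun i => if u i then (1 : ZMod 2) else 0) ∈ F2Elim.rowSpan I.n L →
            (fun i => if v i then (1 : ZMod 2) else 0) ∈ F2Elim.rowSpan I.n L →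
          ∀ y, ((I.C (Fin.cast hk.symm 1)).eval y ^^
            (I.C (Fin.cast hk.symm 1)).eval (bxor y u) ^^ (I.C (Fin.cast hk.symm 1)).eval (bxor y v) ^^
            (I.C (Fin.cast hk.symm 1)).eval (bxor y (bxor u v))) = false}) →
    (∀ (n : ℕ) (f g : (Fin n → Bool) → Bool) (V : Finset (Fin n → Bool)),
      zeroVec ∈ V → (∀ x ∈ V, ∀ y ∈ V, bxor x y ∈ V) →
      (∀ u ∈ V, ∀ v ∈ V, ∀ y, (g y ^^ g (bxor y u) ^^ g (bxor y v) ^^ g (bxor y (bxor u v))) = false) →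
      (∑ z : Fin n → Bool,
          ∑ x ∈ univ.filter (fun x => ∀ v ∈ V, twist x v = signOf (g (bxor z v)) * signOf (g z)),
            signOf (f x) * signOf (g z) * twist x z =
        Real.sqrt (2 ^ (3 * n)) * forrelation f g) ∧
      (∀ z : Fin n → Bool,
        ((univ.filter (fun x => ∀ v ∈ V, twist x v = signOf (g (bxor z v)) * signOf (g z))).card : ℝ) *
          V.card = (2 : ℝ) ^ n)) →
    (∀ (n : ℕ) (g : (Fin n → Bool) → Bool), IsDegLeFun 3 g →
      ∀ L : List (List Bool),
      (∀ r ∈ L, ∀ s ∈ L, ∀ y : Fin n → Bool, (y = zeroVec ∨ ∃ i : Fin n, y = fun j => decide (j = i)) →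
        (g y ^^ g (bxor y (fun i => r.getD i false)) ^^ g (bxor y (fun i => s.getD i false)) ^^
          g (bxor y (bxor (fun i => r.getD i false) (fun i => s.getD i false)))) = false) →
      ∀ u v : Fin n → Bool, (fun i => if u i then (1 : ZMod 2) else 0) ∈ F2Elim.rowSpan n L →
        (fun i => if v i then (1 : ZMod 2) else 0) ∈ F2Elim.rowSpan n L →
      ∀ y, (g y ^^ g (bxor y u) ^^ g (bxor y v) ^^ g (bxor y (bxor u v))) = false) →
    ∃ dec ∈ FP, ∃ p : Polynomial ℕ,
      (∀ x ∈ (signedCubicForrelationProblem 2).yes,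
        uniformProb (p.eval x.length) {y | dec (boolPair x y) = [false]} ≤ 1 / 10) ∧
      (∀ x ∈ (signedCubicForrelationProblem 2).no,
        uniformProb (p.eval x.length) {y | dec (boolPair x y) = [true]} ≤ 1 / 10) ∧
      (∀ x ∈ KForrelationInstance.encode ''
          {I | I.IsYes ∧ (∃ i, ∃ V : Finset (Fin I.n → Bool), zeroVec ∈ V ∧
            (∀ x ∈ V, ∀ y ∈ V, bxor x y ∈ V) ∧ (V.card : ℝ) ^ 2 = (2 : ℝ) ^ I.n ∧
            ∀ u ∈ V, ∀ v ∈ V, ∀ y, ((I.C i).eval y ^^ (I.C i).eval (bxor y u) ^^ (I.C i).eval (bxor y v) ^^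
              (I.C i).eval (bxor y (bxor u v))) = false) ∧
            I.k = 2 ∧ Even I.n ∧ ∀ i, IsDegLeFun 3 (I.C i).eval},
        (9 / 10 : ℝ) ≤ uniformProb (p.eval x.length) {y | dec (boolPair x y) = [true]}) ∧
      (∀ x ∈ KForrelationInstance.encode ''
          {I | (I.IsOverB2 ∧ I.value ≤ -(3 / 5 : ℝ)) ∧ (∃ i, ∃ V : Finset (Fin I.n → Bool), zeroVec ∈ V ∧
            (∀ x ∈ V, ∀ y ∈ V, bxor x y ∈ V) ∧ (V.card : ℝ) ^ 2 = (2 : ℝ) ^ I.n ∧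
            ∀ u ∈ V, ∀ v ∈ V, ∀ y, ((I.C i).eval y ^^ (I.C i).eval (bxor y u) ^^ (I.C i).eval (bxor y v) ^^
              (I.C i).eval (bxor y (bxor u v))) = false) ∧
            I.k = 2 ∧ Even I.n ∧ ∀ i, IsDegLeFun 3 (I.C i).eval},
        (9 / 10 : ℝ) ≤ uniformProb (p.eval x.length) {y | dec (boolPair x y) = [false]}) :=
  stub_safeMM_of_safeMMR stub_safeMMR

end Summit.QuantumAdvantage.QuantumAdvantage.Theorems.SignedCubicForrelationInPrBPP

end
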